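import Literature.AlgebraicGeometry.Frobenioids.PadicKummerDualityIso
import Literature.AlgebraicGeometry.Frobenioids.KummerLocalDualityBinding
import Literature.AlgebraicGeometry.Frobenioids.PadicKummerThm24iCupProduct
import Literature.AlgebraicGeometry.Frobenioids.PadicKummerSaturatedCofinal
import Literature.AlgebraicGeometry.Frobenioids.PadicKummerSettingGaloisProofs
import Literature.AnabelianGeometry.AbsoluteAnabelian.MLFGaloisGroupsHolds
import HarnessLib

/-!
# Frobenioids II, Def. 2.2 (ii) / Thm. 2.4 (i) at the local-field binding: the duality isomorphism
# with NO residual input, its naturality "(γ₁)", and Theorem 2.4 (i) modulo `hfs` only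

Mochizuki, *The geometry of Frobenioids II*, Kyushu J. Math. **62** (2008) 401–460, §2: Definition
2.2 (ii) p. 18 — "by the well-known duality theory of nonarchimedean [mixed-characteristic] local
fields [cf., e.g., [NSW], Chapter 7, Theorem 7.2.6] the cup product on group cohomology determines an
isomorphism `H¹(H, μ_N(A)) ⥲ H^ab ⊗ H²(H, μ_N(A))`, hence [by applying condition (c)] an isomorphism
`H¹(H_A, μ_N(A)) ⥲ H_A^ab ⊗ F_N(A)`" — and Theorem 2.4 (i) pp. 19–20 [cite: MochizukiFrdII2008,
Def 2.2 (ii) p.18].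

Assembly (abc-iut-L2-t12, cell row L1-γ₁ "CONSUME") at abc-iut-L1-t7's arithmetic context
`X = Def22Context.ofLocalField L H hH S` (`K` a non-archimedean local field of characteristic `0`,
`H ⊆ G_K` open normal, `A_E = Spec L`, `O^□(A) = O^□_L` a `Gal(L/K)`-stable submonoid `S ⊆ L`):
the datum `Kummer.DualityIso` of Definition 2.2 (ii) — carried since the typing as an explicit
HYPOTHESIS STRUCTURE ("TODO-merge: LCFT") — is now CONSTRUCTED with no residual input beyond the
object's own printed standing hypotheses "`A` is `(N, H)`-saturated" (`IsNHSaturated X N`) and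
"`O^□_L ∋` the `N`-th roots of unity of `L`" (`hS`; automatic for `O^▷_L` / `O^×_L`,
`mem_boxStableSubmonoid_of_pow_eq_one`). For an ARBITRARY context `X` first (all cohomological
objects through context-level wrappers `DualityIsoOf X N`, `thetaHomOf X N`, `cupDualOf X N`, like the
landed `FN X N` / `cupDualHOf X N`, so that they may be written at the bindings), then at the binding:
* `Def22Context.dualityIsoOfBijective X N hθ hcup` / **`Def22Context.dualityIsoOfLocalField L H hH S N
  hS h : DualityIsoOf (ofLocalField L H hH S) N`** — the cup-product isomorphism
  `Kummer.dualityIsoOfCupProduct` (abc-iut-L2-t12) with BOTH bijectivity inputs discharged: `θ` from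
  `H_A` finite and `F_N(A) ≅ ℤ/Nℤ` (`nonempty_fn_equiv_zmod_ofLocalField`, abc-iut-L1-t7), `cupDual`
  from condition (c) and local Tate duality for the open `H ≤ G_K` (`cupDualH_bijective_ofLocalField`,
  abc-iut-w5-d207, `KummerLocalDualityBinding.lean`, over the trunk's `powAdjoint_bijective_local`);
  it IS `dualityIsoOfLocalDuality X N e h hH` for every choice of the auxiliary data (`rfl`);
* `Def22Context.Iso.recTargetMap_dualityIsoOfLocalField` — Theorem 2.4 (i) "(γ₁)":
  `(isoHA^ab ⊗ isoFN) ∘ ι₁ = ι₂ ∘ isoH1` for these isomorphisms along EVERY isomorphism of two such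
  contexts (over possibly different base fields), unconditionally;
* `Def22Context.Iso.thm24i_ofLocalField` — the typed **Theorem 2.4 (i)** (`PadicKummer.Thm24i`) for
  every isomorphism of two local-field contexts over `Kᵢ ⊇ ℚ_{pᵢ}`, with `p₁ = p₂` DERIVED from
  [AbsAnab] Prop. 1.2.1 (i) (`galoisMLF_iso_residueChar_eq_holds`, abc-iut-L4) and the duality
  isomorphisms the constructed ones: conditional ONLY on `hfs : fs₁ ↔ fs₂` ("`Φ₁` fieldwise saturated
  iff `Φ₂`", [FrdI] Cor. 4.10/4.11 — a statement about the divisor monoids of the `pᵢ`-adic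
  FROBENIOIDS, invisible at the level of Definition 2.2 contexts; cell row W12-L03);
* `Def22Context.exists_dualityIso_hypotheses_ofLocalField` — the hypotheses are met COFINALLY
  (Rmk. 2.2.1, abc-iut-L1-t7's `exists_saturated_kummerHypotheses_ofLocalField`), so the isomorphism
  and the reciprocity map of Definition 2.3 (`reciprocityMapOfLocalField`) exist with no residual input
  above every `A′`.
No new notion: the `…Of` declarations are context-level abbreviations of landed `Kummer.*` objects.
Nothing here concerns [IUTchIII]; this is classical (Kummer theory + local Tate duality). Universe `0`.
-/

noncomputable section

namespace Literature.AlgebraicGeometry.Frobenioids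

namespace PadicKummer

namespace Def22Context

open Field IntermediateField Kummer
open Literature.NumberTheory.GaloisRepresentations
open Literature.NumberTheory.GaloisRepresentations.LocalWeilDatum
open Literature.AnabelianGeometry.AbsoluteAnabelian

/-! ### Any context: wrappers and the duality isomorphism from the two bijectivity inputs -/

section AnyContext

variable (X : Def22Context) (N : ℕ)

/-- The type of duality isomorphisms `H¹(H_A, μ_N(A)) ⥲ H_A^ab ⊗ F_N(A)` of a Definition 2.2 context
(`Kummer.DualityIso` at `X.O`, `X.HA`, `X.qHA` — a wrapper fixing the context's own instances, like
`FN X N`, so that it can be written at the bindings `ofGalois` / `ofLocalField`).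
[cite: MochizukiFrdII2008, Def 2.2 (ii) p.18] -/
abbrev DualityIsoOf : Type := Kummer.DualityIso N X.O X.HA X.qHA

/-- The codomain `H_A^ab ⊗ F_N(A)` of the reciprocity map of a context (`Kummer.RecTarget`).
[cite: MochizukiFrdII2008, Def 2.3 p.19] -/
abbrev RecTargetOf : Type := Kummer.RecTarget N X.O X.HA X.qHA

/-- `θ : H_A^ab ⊗ F_N(A) → Hom(Hom(H_A^ab, ℤ/N), F_N(A))` of a context (abc-iut-L2-t12's
`Kummer.thetaHom`). [cite: MochizukiFrdII2008, Def 2.2 (ii) p.18] -/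
abbrev thetaHomOf := Kummer.thetaHom N X.O X.HA X.qHA

/-- The adjoint cup product `H¹(H_A, μ_N(A)) → Hom(Hom(H_A^ab, ℤ/N), F_N(A))`, `x ↦ (χ ↦ x ∪ χ)`, of
a context (abc-iut-L2-t12's `Kummer.cupDual`). [cite: MochizukiFrdII2008, Def 2.2 (ii) p.18] -/
abbrev cupDualOf := Kummer.cupDual N X.O X.HA X.qHA

/-- A duality isomorphism of a context applied to a class: `c ↦ ι(c) ∈ H_A^ab ⊗ F_N(A)` (p. 18 "write
`η_f ∈ H_A^ab ⊗ F_N(A)` for the image of `κ_f` via this last isomorphism"; wrapper at the context's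
instances). [cite: MochizukiFrdII2008, Def 2.2 (ii) p.18] -/
abbrev dualityApply (ι : DualityIsoOf X N)
    (c : groupCohomology.H1 (Rep.ofMulDistribMulAction X.HA (Mu N X.O))) : RecTargetOf X N :=
  ι.toAddEquiv c

variable {X N}

/-- `θ` is bijective once `H_A` is finite and "`F_N(A) ≅ ℤ/Nℤ`" (FrdII p. 18; abc-iut-L2-t12's
`Kummer.thetaHom_bijective`, here from the mere EXISTENCE of such an isomorphism).
[cite: MochizukiFrdII2008, Def 2.2 (ii) p.18] -/
theorem thetaHomOf_bijective [Finite X.HA] [NeZero N] (h : Nonempty (FN X N ≃+ ZMod N)) :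
    Function.Bijective (thetaHomOf X N) :=
  h.elim fun e => thetaHom_bijective N X.O X.HA X.qHA e

/-- `cupDual` is bijective "by applying condition (c)" to local Tate duality for `H` in adjoint form
(`hH`, through `cupDualHOf X N`) — abc-iut-L2-t12's `cupDual_bijective_of_isCohSaturated`.
[cite: MochizukiFrdII2008, Def 2.2 (ii) p.18] -/
theorem cupDualOf_bijective [LocallyCompactSpace X.H] (hc : IsNHSaturated X N)
    (hH : Function.Bijective (cupDualHOf X N)) : Function.Bijective (cupDualOf X N) :=
  cupDual_bijective_of_isCohSaturated hc.cohSaturated hH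

variable (X N)

/-- **The duality isomorphism `H¹(H_A, μ_N(A)) ⥲ H_A^ab ⊗ F_N(A)` of a context from the two
bijectivity inputs** (`θ` and `cupDual` bijective): abc-iut-L2-t12's cup-product construction
`Kummer.dualityIsoOfCupProduct`, at the context's instances. [cite: MochizukiFrdII2008, Def 2.2 (ii) p.18] -/
def dualityIsoOfBijective (hθ : Function.Bijective (thetaHomOf X N))
    (hcup : Function.Bijective (cupDualOf X N)) : DualityIsoOf X N :=
  dualityIsoOfCupProduct N X.O X.HA X.qHA hθ hcup

/-- `dualityIsoOfBijective` IS abc-iut-L2-t12's `dualityIsoOfLocalDuality X N e h hH` for every choice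
of `e : F_N(A) ≅ ℤ/N`, `h`, `hH` (the data enter only through PROOFS of bijectivity).
[cite: MochizukiFrdII2008, Def 2.2 (ii) p.18] -/
theorem dualityIsoOfBijective_eq_dualityIsoOfLocalDuality [NeZero N] [Finite X.HA]
    [LocallyCompactSpace X.H] (hθ : Function.Bijective (thetaHomOf X N))
    (hcup : Function.Bijective (cupDualOf X N)) (e : FN X N ≃+ ZMod N) (h : IsNHSaturated X N)
    (hH : Function.Bijective (cupDualHOf X N)) :
    dualityIsoOfBijective X N hθ hcup = X.dualityIsoOfLocalDuality N e h hH :=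
  rfl

/-- **Characterisation**: `θ (ι c) = cupDual (h1MuEquiv c)` — the isomorphism is the cup product read
through `θ` (FrdII p. 18 "induced by the cup product"). [cite: MochizukiFrdII2008, Def 2.2 (ii) p.18] -/
theorem thetaHomOf_dualityIsoOfBijective (hθ : Function.Bijective (thetaHomOf X N))
    (hcup : Function.Bijective (cupDualOf X N))
    (c : groupCohomology.H1 (Rep.ofMulDistribMulAction X.HA (Mu N X.O))) :
    thetaHomOf X N ((dualityIsoOfBijective X N hθ hcup).toAddEquiv c) =
      cupDualOf X N (h1MuEquiv N X.O X.HA c) :=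
  thetaHom_dualityIsoOfCupProduct N X.O X.HA X.qHA hθ hcup c

/-- **Definition 2.3**, the reciprocity map `O^□(A)^H → H_A^ab ⊗ F_N(A)`, `f ↦ η_f`, of a context
(abc-iut-L1-t4's `Kummer.reciprocityMap` at the context's instances), for given `N`-th-root data and a
duality isomorphism. [cite: MochizukiFrdII2008, Def 2.3 p.19] -/
def reciprocityMapOf (hO : NthRootsDifferByUnits N X.O) (hR : InvariantsAdmitRoots N X.O X.HA)
    (ι : DualityIsoOf X N) :
    invariantsSubmonoid X.O X.HA →* Multiplicative (RecTargetOf X N) :=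
  reciprocityMap hO hR ι

/-- `reciprocityMapOf` sends `f` to `η_f = ι(κ_f)`. [cite: MochizukiFrdII2008, Def 2.3 p.19] -/
theorem reciprocityMapOf_apply (hO : NthRootsDifferByUnits N X.O) (hR : InvariantsAdmitRoots N X.O X.HA)
    (ι : DualityIsoOf X N) (f : invariantsSubmonoid X.O X.HA) :
    reciprocityMapOf X N hO hR ι f =
      Multiplicative.ofAdd (ι.toAddEquiv
        (kummerClass hO X.HA ⟨f, invariantsSubmonoid_le_kummerDomain hR f.2⟩)) :=
  rfl

end AnyContext

/-! ### Any isomorphism of contexts: "(γ₁)" and Theorem 2.4 (i) for `dualityIsoOfBijective` -/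

namespace Iso

variable {X₁ X₂ : Def22Context} (f : Def22Context.Iso X₁ X₂) (N : ℕ)

/-- **Theorem 2.4 (i), "(γ₁)"** for the isomorphisms `dualityIsoOfBijective`: along every isomorphism
of contexts, `(isoHA^ab ⊗ isoFN) ∘ ι₁ = ι₂ ∘ isoH1` (abc-iut-L2-t12's
`recTargetMap_dualityIsoOfCupProduct`). [cite: MochizukiFrdII2008, Thm 2.4 (i) p.19] -/
theorem recTargetMap_dualityIsoOfBijective
    (hθ₁ : Function.Bijective (thetaHomOf X₁ N)) (hcup₁ : Function.Bijective (cupDualOf X₁ N))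
    (hθ₂ : Function.Bijective (thetaHomOf X₂ N)) (hcup₂ : Function.Bijective (cupDualOf X₂ N))
    (c : groupCohomology.H1 (Rep.ofMulDistribMulAction X₁.HA (Mu N X₁.O))) :
    (f.thm24Data N).recTargetMap ((dualityIsoOfBijective X₁ N hθ₁ hcup₁).toAddEquiv c) =
      (dualityIsoOfBijective X₂ N hθ₂ hcup₂).toAddEquiv (f.isoH1 N c) :=
  f.recTargetMap_dualityIsoOfCupProduct N hθ₁ hcup₁ hθ₂ hcup₂ c

/-- **Theorem 2.4 (i)** for the isomorphisms `dualityIsoOfBijective`, modulo the two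
non-cohomological residuals `hp : p₁ = p₂`, `hfs : fs₁ ↔ fs₂` (abc-iut-L1-d4's `thm24i_of_inputs` with
the naturality input PROVED). [cite: MochizukiFrdII2008, Thm 2.4 (i) p.19] -/
theorem thm24i_of_bijective [NeZero N] (p₁ p₂ : ℕ) (fs₁ fs₂ : Prop) (hp : p₁ = p₂) (hfs : fs₁ ↔ fs₂)
    (hθ₁ : Function.Bijective (thetaHomOf X₁ N)) (hcup₁ : Function.Bijective (cupDualOf X₁ N))
    (hθ₂ : Function.Bijective (thetaHomOf X₂ N)) (hcup₂ : Function.Bijective (cupDualOf X₂ N)) :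
    Thm24i X₁ X₂ N p₁ p₂ fs₁ fs₂ (f.thm24Data N) (dualityIsoOfBijective X₁ N hθ₁ hcup₁)
      (dualityIsoOfBijective X₂ N hθ₂ hcup₂) :=
  f.thm24i_of_inputs N p₁ p₂ fs₁ fs₂ _ _ hp hfs
    (f.recTargetMap_dualityIsoOfBijective N hθ₁ hcup₁ hθ₂ hcup₂)

end Iso

/-! ### The two instance facts at the binding `ofLocalField` -/

section Instances

variable {K : Type} [Field K] (L : IntermediateField K (AlgebraicClosure K)) [Normal K L]
  [FiniteDimensional K L] (H : Subgroup (absoluteGaloisGroup K)) [H.Normal]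
  (hH : IsOpen (H : Set (absoluteGaloisGroup K))) (S : StableSubmonoid L)

/-- `H_A = Im(H → Gal(L/K))` is finite (FrdII p. 17: `Aut_E(A_E) = Gal(L/K)` for the finite Galois
`A_E = Spec L`). [cite: MochizukiFrdII2008, Def 2.2 (i) p.17] -/
theorem finite_HA_ofLocalField : Finite (ofLocalField L H hH S).HA :=
  inferInstanceAs (Finite (H.map (resGal L)))

/-- `H` is locally compact (open, hence closed, in the profinite `G_K`; abc-iut-w5-d207's
`locallyCompactSpace_H_ofGalois`). [cite: MochizukiFrdII2008, Def 2.2 (i) p.17] -/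
theorem locallyCompactSpace_H_ofLocalField [CharZero K] :
    LocallyCompactSpace (ofLocalField L H hH S).H :=
  locallyCompactSpace_H_ofGalois L (GalMonoid S) H hH (MonoidHom.id _) (fun _ _ => rfl)

end Instances

/-! ### The duality isomorphism of Definition 2.2 (ii) at `ofLocalField`, no residual input -/

section LocalField

variable {K : Type} [Field K] [ValuativeRel K] [TopologicalSpace K] [IsNonarchimedeanLocalField K]
  [CharZero K] (L : IntermediateField K (AlgebraicClosure K)) [Normal K L] [FiniteDimensional K L]
  (H : Subgroup (absoluteGaloisGroup K)) [H.Normal] (hH : IsOpen (H : Set (absoluteGaloisGroup K)))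
  (S : StableSubmonoid L) (N : ℕ) [NeZero N]

omit [ValuativeRel K] [TopologicalSpace K] [IsNonarchimedeanLocalField K] in
/-- An `(N, H)`-saturated `A` is `μ_N`-saturated, so `μ_N(K̄) ⊆ L` (FrdII Def. 2.2 (ii)(a) with
[FrdI] Def. 1.1 (iv)(a) "`μ_N(A) ≅ ℤ/Nℤ`"). [cite: MochizukiFrdII2008, Def 2.2 (ii) p.17] -/
theorem rootsOfUnity_mem_of_isNHSaturated (h : IsNHSaturated (ofLocalField L H hH S) N)
    (ζ : rootsOfUnity N (AlgebraicClosure K)) :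
    ((ζ : (AlgebraicClosure K)ˣ) : AlgebraicClosure K) ∈ L :=
  coe_rootsOfUnity_mem_of_isMuSaturated L S N h.muSaturated ζ

/-- **`θ` is bijective at the binding** — from `H_A` finite and "`F_N(A) ≅ ℤ/Nℤ`" (FrdII p. 18,
[NSW 7.2.6]; abc-iut-L1-t7's `nonempty_fn_equiv_zmod_ofLocalField`), for an `(N, H)`-saturated `A`
with `O^□_L ∋` the `N`-th roots of unity of `L`. [cite: MochizukiFrdII2008, Def 2.2 (ii) p.18] -/
theorem thetaHom_bijective_ofLocalField (hS : ∀ x : L, x ^ N = 1 → x ∈ S.toSubmonoid)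
    (h : IsNHSaturated (ofLocalField L H hH S) N) :
    Function.Bijective (thetaHomOf (ofLocalField L H hH S) N) :=
  haveI := finite_HA_ofLocalField L H hH S
  thetaHomOf_bijective (nonempty_fn_equiv_zmod_ofLocalField L H hH S N hS
    (rootsOfUnity_mem_of_isNHSaturated L H hH S N h) h)

/-- **Local Tate duality for `H`, adjoint form, at the binding** (the input `hH` of
`dualityIsoOfLocalDuality`): abc-iut-w5-d207's `cupDualH_bijective_ofLocalField`, with `μ_N(K̄) ⊆ L`
read off the saturation and the local compactness of `H` supplied.
[cite: MochizukiFrdII2008, Def 2.2 (ii) p.18] -/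
theorem cupDualH_bijective_ofLocalField_of_isNHSaturated
    (hS : ∀ x : L, x ^ N = 1 → x ∈ S.toSubmonoid) (h : IsNHSaturated (ofLocalField L H hH S) N) :
    haveI := locallyCompactSpace_H_ofLocalField L H hH S
    Function.Bijective (cupDualHOf (ofLocalField L H hH S) N) :=
  haveI := locallyCompactSpace_H_ofLocalField L H hH S
  cupDualH_bijective_ofLocalField L H hH S N hS (rootsOfUnity_mem_of_isNHSaturated L H hH S N h)

/-- **`cupDual` is bijective at the binding** — "by applying condition (c)" to local Tate duality for
`H`. [cite: MochizukiFrdII2008, Def 2.2 (ii) p.18] -/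
theorem cupDual_bijective_ofLocalField (hS : ∀ x : L, x ^ N = 1 → x ∈ S.toSubmonoid)
    (h : IsNHSaturated (ofLocalField L H hH S) N) :
    Function.Bijective (cupDualOf (ofLocalField L H hH S) N) :=
  haveI := locallyCompactSpace_H_ofLocalField L H hH S
  cupDualOf_bijective h (cupDualH_bijective_ofLocalField_of_isNHSaturated L H hH S N hS h)

/-- **Definition 2.2 (ii): the duality isomorphism `H¹(H_A, μ_N(A)) ⥲ H_A^ab ⊗ F_N(A)` of the
arithmetic context `ofLocalField L H hH S`, CONSTRUCTED with no residual input** — hypotheses = the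
printed standing ones ("`A` is `(N, H)`-saturated", `O^□_L ∋` the roots of unity of `L`).
[cite: MochizukiFrdII2008, Def 2.2 (ii) p.18] -/
def dualityIsoOfLocalField (hS : ∀ x : L, x ^ N = 1 → x ∈ S.toSubmonoid)
    (h : IsNHSaturated (ofLocalField L H hH S) N) : DualityIsoOf (ofLocalField L H hH S) N :=
  dualityIsoOfBijective _ N (thetaHom_bijective_ofLocalField L H hH S N hS h)
    (cupDual_bijective_ofLocalField L H hH S N hS h)

/-- `dualityIsoOfLocalField` IS `dualityIsoOfLocalDuality X N e h hH` for every choice of the auxiliary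
data `e`, `hH`. [cite: MochizukiFrdII2008, Def 2.2 (ii) p.18] -/
theorem dualityIsoOfLocalField_eq_dualityIsoOfLocalDuality [Finite (ofLocalField L H hH S).HA]
    [LocallyCompactSpace (ofLocalField L H hH S).H]
    (hS : ∀ x : L, x ^ N = 1 → x ∈ S.toSubmonoid) (h : IsNHSaturated (ofLocalField L H hH S) N)
    (e : FN (ofLocalField L H hH S) N ≃+ ZMod N)
    (hH' : Function.Bijective (cupDualHOf (ofLocalField L H hH S) N)) :
    dualityIsoOfLocalField L H hH S N hS h = (ofLocalField L H hH S).dualityIsoOfLocalDuality N e h hH' :=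
  rfl

/-- **Definition 2.3 at the binding, no duality datum**: the reciprocity map
`O^□(A)^H → H_A^ab ⊗ F_N(A)`, `f ↦ η_f`, of an `(N, H)`-saturated arithmetic `A` with `O^□_L ∋` the
roots of unity (so `N`-th roots differ by units, abc-iut-L1-t7's `GalMonoid.nthRootsDifferByUnits`)
on which "any `f ∈ O^□(A)^H` admits an `N`-th root" (`hR`, Rmk. 2.2.1 —
`saturatedInvariantsAdmitRoots_ofLocalField_box` when `Gal(K̄/L) ≤ H`), fed with the CONSTRUCTED
duality isomorphism. [cite: MochizukiFrdII2008, Def 2.3 p.19] -/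
def reciprocityMapOfLocalField (hS : ∀ x : L, x ^ N = 1 → x ∈ S.toSubmonoid)
    (h : IsNHSaturated (ofLocalField L H hH S) N)
    (hR : InvariantsAdmitRoots N (ofLocalField L H hH S).O (ofLocalField L H hH S).HA) :
    invariantsSubmonoid (ofLocalField L H hH S).O (ofLocalField L H hH S).HA →*
      Multiplicative (RecTargetOf (ofLocalField L H hH S) N) :=
  reciprocityMapOf _ N (GalMonoid.nthRootsDifferByUnits S N hS) hR
    (dualityIsoOfLocalField L H hH S N hS h)

omit [CharZero K] in
/-- **Remark 2.2.1 / Definition 2.3: the hypotheses are met cofinally.** Above every finite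
`L′ ⊆ K̄` and for every `N ≥ 1`, `H`, and either choice `fs` of `O^□` (Def. 2.2 (iii)), there is a
finite Galois `L ⊇ L′` with `Gal(K̄/L) ≤ H` such that `A = (L, O^□_L)` is `(N, H)`-saturated,
`O^□_L ∋` the roots of unity, and every `f ∈ O^□(A)^H` admits an `N`-th root — so
`dualityIsoOfLocalField` and `reciprocityMapOfLocalField` are defined there with no residual input
(abc-iut-L1-t7's `exists_saturated_kummerHypotheses_ofLocalField`).
[cite: MochizukiFrdII2008, Rmk 2.2.1 p.18] -/
theorem exists_dualityIso_hypotheses_ofLocalField [CharZero K]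
    (L' : IntermediateField K (AlgebraicClosure K)) [FiniteDimensional K L'] (fs : Prop) :
    ∃ L : IntermediateField K (AlgebraicClosure K), ∃ (_ : FiniteDimensional K L)
      (_ : IsGalois K L), L' ≤ L ∧ galFixing K L ≤ H ∧
        (∀ x : L, x ^ N = 1 → x ∈ (boxStableSubmonoid K L fs).toSubmonoid) ∧
        IsNHSaturated (ofLocalField L H hH (boxStableSubmonoid K L fs)) N ∧
        InvariantsAdmitRoots N (GalMonoid (boxStableSubmonoid K L fs))
          (ofLocalField L H hH (boxStableSubmonoid K L fs)).HA := by
  obtain ⟨L, hfin, hgal, hle, hHL, hsat, hR, -, -⟩ :=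
    exists_saturated_kummerHypotheses_ofLocalField L' H hH N fs
  exact ⟨L, hfin, hgal, hle, hHL,
    fun x hx => mem_boxStableSubmonoid_of_pow_eq_one K L N fs (NeZero.pos N) hx, hsat, hR⟩

end LocalField

/-! ### Theorem 2.4 (i) "(γ₁)" and Theorem 2.4 (i) itself, for two local-field contexts -/

namespace Iso

variable {K₁ : Type} [Field K₁] [ValuativeRel K₁] [TopologicalSpace K₁]
  [IsNonarchimedeanLocalField K₁] [CharZero K₁]
  {K₂ : Type} [Field K₂] [ValuativeRel K₂] [TopologicalSpace K₂]
  [IsNonarchimedeanLocalField K₂] [CharZero K₂]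
  {L₁ : IntermediateField K₁ (AlgebraicClosure K₁)} [Normal K₁ L₁] [FiniteDimensional K₁ L₁]
  {H₁ : Subgroup (absoluteGaloisGroup K₁)} [H₁.Normal] {hH₁ : IsOpen (H₁ : Set (absoluteGaloisGroup K₁))}
  {S₁ : StableSubmonoid L₁}
  {L₂ : IntermediateField K₂ (AlgebraicClosure K₂)} [Normal K₂ L₂] [FiniteDimensional K₂ L₂]
  {H₂ : Subgroup (absoluteGaloisGroup K₂)} [H₂.Normal] {hH₂ : IsOpen (H₂ : Set (absoluteGaloisGroup K₂))}
  {S₂ : StableSubmonoid L₂}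
  (f : Iso (ofLocalField L₁ H₁ hH₁ S₁) (ofLocalField L₂ H₂ hH₂ S₂)) (N : ℕ) [NeZero N]

/-- **Theorem 2.4 (i), "(γ₁)", unconditionally at the binding**: along EVERY isomorphism `f` of two
local-field contexts (over possibly different base fields), the constructed duality isomorphisms
satisfy `(isoHA^ab ⊗ isoFN) ∘ ι₁ = ι₂ ∘ isoH1` (stated through the wrapper `dualityApply`, the
context's own instances). [cite: MochizukiFrdII2008, Thm 2.4 (i) p.19] -/
theorem recTargetMap_dualityIsoOfLocalField
    (hS₁ : ∀ x : L₁, x ^ N = 1 → x ∈ S₁.toSubmonoid) (h₁ : IsNHSaturated (ofLocalField L₁ H₁ hH₁ S₁) N)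
    (hS₂ : ∀ x : L₂, x ^ N = 1 → x ∈ S₂.toSubmonoid) (h₂ : IsNHSaturated (ofLocalField L₂ H₂ hH₂ S₂) N)
    (c : groupCohomology.H1 (Rep.ofMulDistribMulAction (ofLocalField L₁ H₁ hH₁ S₁).HA
      (Mu N (ofLocalField L₁ H₁ hH₁ S₁).O))) :
    (f.thm24Data N).recTargetMap (dualityApply _ N (dualityIsoOfLocalField L₁ H₁ hH₁ S₁ N hS₁ h₁) c) =
      dualityApply _ N (dualityIsoOfLocalField L₂ H₂ hH₂ S₂ N hS₂ h₂) (f.isoH1 N c) :=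
  f.recTargetMap_dualityIsoOfBijective N _ _ _ _ c

/-- **Theorem 2.4 (i) at the local-field binding, conditional ONLY on `hfs`.** For base fields
`Kᵢ ⊇ ℚ_{pᵢ}` (finite) and every isomorphism `f` of the contexts `ofLocalField Lᵢ Hᵢ … Sᵢ`
(`Sᵢ ∋` the roots of unity, `A₁` `(N, H₁)`-saturated), the typed `Thm24i` holds for the comparison
data `f.thm24Data N` and the CONSTRUCTED duality isomorphisms: "`p₁ = p₂`" is [AbsAnab] Prop. 1.2.1
(i) (`galoisMLF_iso_residueChar_eq_holds`, through abc-iut-L1-d4's `residueChar_eq_of_iso_ofGalois`);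
saturation of `A₂`, `F_N(Aᵢ) ≅ ℤ/N`, Kummer compatibility and (γ₁) are PROVED; local Tate duality for
`Hᵢ` is `cupDualH_bijective_ofLocalField`. The one residual named input is "`Φ₁` is fieldwise
saturated iff `Φ₂` is" ([FrdI] Cor. 4.10/4.11, a statement about the `pᵢ`-adic Frobenioids' divisor
monoids — cell row W12-L03). [cite: MochizukiFrdII2008, Thm 2.4 (i) p.19] -/
theorem thm24i_ofLocalField {p₁ p₂ : ℕ} [Fact p₁.Prime] [Fact p₂.Prime]
    [Algebra ℚ_[p₁] K₁] [FiniteDimensional ℚ_[p₁] K₁] [Algebra ℚ_[p₂] K₂] [FiniteDimensional ℚ_[p₂] K₂]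
    (fs₁ fs₂ : Prop) (hfs : fs₁ ↔ fs₂)
    (hS₁ : ∀ x : L₁, x ^ N = 1 → x ∈ S₁.toSubmonoid) (h₁ : IsNHSaturated (ofLocalField L₁ H₁ hH₁ S₁) N)
    (hS₂ : ∀ x : L₂, x ^ N = 1 → x ∈ S₂.toSubmonoid) :
    Thm24i (ofLocalField L₁ H₁ hH₁ S₁) (ofLocalField L₂ H₂ hH₂ S₂) N p₁ p₂ fs₁ fs₂ (f.thm24Data N)
      (dualityIsoOfLocalField L₁ H₁ hH₁ S₁ N hS₁ h₁)
      (dualityIsoOfLocalField L₂ H₂ hH₂ S₂ N hS₂ ((f.isNHSaturated_iff N).mp h₁)) :=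
  f.thm24i_of_bijective N p₁ p₂ fs₁ fs₂
    (residueChar_eq_of_iso_ofGalois f galoisMLF_iso_residueChar_eq_holds) hfs _ _ _ _

end Iso

end Def22Context

end PadicKummer

end Literature.AlgebraicGeometry.Frobenioids

end
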